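import Literature.Topology.FourManifolds.TrisectionsTubeModel
import HarnessLib

/-!
# The second sector's function on the tube saturation: no critical points (model computation)

Topic `Literature/Topology/FourManifolds`; step E4c (model part) of a Morse-theoretic
construction of Gay–Kirby's trisection for the fact seat
`provefact-Literature.Topology.FourManifolds.exists_isBalancedGKTrisection` (Gay–Kirby 2016,
Thm. 4 via §4, Lemma 14).  Everything in this file is **proved**; the definitions are explicit
functions on `ℝ⁴`.

In Milnor's coordinates `u = (x⃗, y⃗)` of a `2`-handle (`A = |x⃗|²`, `B = |y⃗|²`, `P = AB`,
height `s = η - A + B`), on the saturation of the thin tube about the attaching circle and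
outside the chart zone, the second sector's function reads

  `G(u) = s · (T_P(P) - s) · w(c₀ 𝒯(u))`

with `𝒯 = tube ε κ η` the tube function of `TrisectionsTubeModel.lean` (there the lifted
Heegaard function is `c₀ 𝒯` and the top height is `T_P(P)`).  Testing `dG` against the radial
field in `x⃗`, the radial field in `y⃗` and the rotation field in `x⃗`
(`fderiv_satFn_radialX`, `…_radialY`, `…_rotX`) shows (`TubeSaturation.eq_of_fderiv_satFn_eq_zero`):

**if `dG(u) = 0` at a point with `x⃗ ≠ 0`, `s > 0`, `T_P(P) - s > 0`, `w > 0`, `w' < 0`,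
`T_P' ≤ 0`, `c₀, ε, κ/η > 0`, then `y⃗ = 0`, `x₀x₁ = 0` and `2s = T_P(0)`** — the critical
points lie on the stable disc of the critical point, on the axes, at the single height
`T_P(0)/2`.  Since the saturation region of the construction has `s ≤ η/2 < T_P(0)/2`, the
second sector's function has no critical point there (`TubeSaturation.fderiv_satFn_ne_zero`).

## References

* D. Gay, R. Kirby, *Trisecting 4-manifolds*, Geom. Topol. 20 (2016), §4, Lemma 14. [GayKirby2016]
* J. Milnor, *Lectures on the h-cobordism theorem* (1965), Def. 3.1, proof of Thm. 3.12. [MilnorHCobordism1965]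
-/

open scoped Topology
open Set Function Filter

noncomputable section

namespace Literature.Topology.FourManifolds

/-- Local notation: `𝔼 n` is the model Euclidean space `EuclideanSpace ℝ (Fin n)`. -/
local notation "𝔼 " n:arg => EuclideanSpace ℝ (Fin n)

namespace TubeSaturation

open TubeModel RadialThickening

/-! ### The height, the first integral, and the function -/

/-- The height `s = η - |x⃗|² + |y⃗|²`. [cite: MilnorHCobordism1965, Def. 3.1] -/
def sM (η : ℝ) (u : 𝔼 4) : ℝ := η - nsq (proj u) + bsq u

/-- The first integral `P = |x⃗|² |y⃗|²`. [cite: MilnorHCobordism1965, proof of Thm. 3.12] -/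
def PM (u : 𝔼 4) : ℝ := nsq (proj u) * bsq u

/-- **The second sector's function on the tube saturation**
`G = s · (T_P(P) - s) · w(c₀ 𝒯)`. [cite: GayKirby2016, §4, Lemma 14] -/
def satFn (TP w : ℝ → ℝ) (c₀ ε κ η : ℝ) (u : 𝔼 4) : ℝ :=
  sM η u * (TP (PM u) - sM η u) * w (c₀ * tube ε κ η u)

/-- Unfolding. [folklore] -/
theorem sM_apply (η : ℝ) (u : 𝔼 4) : sM η u = η - nsq (proj u) + bsq u := rfl
/-- Unfolding. [folklore] -/
theorem PM_apply (u : 𝔼 4) : PM u = nsq (proj u) * bsq u := rfl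
/-- Unfolding. [folklore] -/
theorem satFn_apply (TP w : ℝ → ℝ) (c₀ ε κ η : ℝ) (u : 𝔼 4) :
    satFn TP w c₀ ε κ η u = sM η u * (TP (PM u) - sM η u) * w (c₀ * tube ε κ η u) := rfl

/-! ### The three test vectors -/

/-- The radial vector in `x⃗`: `(u₀, u₁, 0, 0)`. [folklore] -/
def radialX (u : 𝔼 4) : 𝔼 4 := WithLp.toLp 2 ![u 0, u 1, 0, 0]
/-- The radial vector in `y⃗`: `(0, 0, u₂, u₃)`. [folklore] -/
def radialY (u : 𝔼 4) : 𝔼 4 := WithLp.toLp 2 ![0, 0, u 2, u 3]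
/-- The rotation vector in `x⃗`: `(-u₁, u₀, 0, 0)`. [folklore] -/
def rotX (u : 𝔼 4) : 𝔼 4 := WithLp.toLp 2 ![-u 1, u 0, 0, 0]

/-- Coordinate of a test vector. [folklore] -/
@[simp] theorem radialX_apply_zero (u : 𝔼 4) : radialX u 0 = u 0 := rfl
/-- Coordinate of a test vector. [folklore] -/
@[simp] theorem radialX_apply_one (u : 𝔼 4) : radialX u 1 = u 1 := rfl
/-- Coordinate of a test vector. [folklore] -/
@[simp] theorem radialX_apply_two (u : 𝔼 4) : radialX u 2 = 0 := rfl
/-- Coordinate of a test vector. [folklore] -/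
@[simp] theorem radialX_apply_three (u : 𝔼 4) : radialX u 3 = 0 := rfl
/-- Coordinate of a test vector. [folklore] -/
@[simp] theorem radialY_apply_zero (u : 𝔼 4) : radialY u 0 = 0 := rfl
/-- Coordinate of a test vector. [folklore] -/
@[simp] theorem radialY_apply_one (u : 𝔼 4) : radialY u 1 = 0 := rfl
/-- Coordinate of a test vector. [folklore] -/
@[simp] theorem radialY_apply_two (u : 𝔼 4) : radialY u 2 = u 2 := rfl
/-- Coordinate of a test vector. [folklore] -/
@[simp] theorem radialY_apply_three (u : 𝔼 4) : radialY u 3 = u 3 := rfl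
/-- Coordinate of a test vector. [folklore] -/
@[simp] theorem rotX_apply_zero (u : 𝔼 4) : rotX u 0 = -u 1 := rfl
/-- Coordinate of a test vector. [folklore] -/
@[simp] theorem rotX_apply_one (u : 𝔼 4) : rotX u 1 = u 0 := rfl
/-- Coordinate of a test vector. [folklore] -/
@[simp] theorem rotX_apply_two (u : 𝔼 4) : rotX u 2 = 0 := rfl
/-- Coordinate of a test vector. [folklore] -/
@[simp] theorem rotX_apply_three (u : 𝔼 4) : rotX u 3 = 0 := rfl

/-! ### Derivatives of the ingredients -/

/-- `D(|x⃗|²)_u(v) = 2u₀v₀ + 2u₁v₁`. [folklore] -/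
theorem hasFDerivAt_nsq_proj (u : 𝔼 4) :
    HasFDerivAt (fun u : 𝔼 4 => nsq (proj u))
      (((2 * u 0) • (d0 : 𝔼 2 →L[ℝ] ℝ) + (2 * u 1) • (d1 : 𝔼 2 →L[ℝ] ℝ)).comp proj) u := by
  exact (hasFDerivAt_nsq (proj u)).comp u proj.hasFDerivAt

/-- `D(|x⃗|²)(v) = 2u₀v₀ + 2u₁v₁`. [folklore] -/
theorem fderiv_nsq_proj_apply (u v : 𝔼 4) :
    fderiv ℝ (fun u : 𝔼 4 => nsq (proj u)) u v = 2 * u 0 * v 0 + 2 * u 1 * v 1 := by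
  rw [(hasFDerivAt_nsq_proj u).fderiv]
  simp

/-- `|x⃗|²` is differentiable. [folklore] -/
theorem differentiableAt_nsq_proj (u : 𝔼 4) : DifferentiableAt ℝ (fun u : 𝔼 4 => nsq (proj u)) u :=
  (hasFDerivAt_nsq_proj u).differentiableAt

/-- `s` is differentiable. [folklore] -/
theorem differentiableAt_sM (η : ℝ) (u : 𝔼 4) : DifferentiableAt ℝ (sM η) u :=
  ((differentiableAt_const η).sub (differentiableAt_nsq_proj u)).add (hasFDerivAt_bsq u).differentiableAt

/-- `ds(v) = -(2u₀v₀ + 2u₁v₁) + (2u₂v₂ + 2u₃v₃)`. [folklore] -/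
theorem fderiv_sM_apply (η : ℝ) (u v : 𝔼 4) :
    fderiv ℝ (sM η) u v = -(2 * u 0 * v 0 + 2 * u 1 * v 1) + (2 * u 2 * v 2 + 2 * u 3 * v 3) := by
  have hsM : HasFDerivAt (sM η) _ u := ((hasFDerivAt_const η u).sub (hasFDerivAt_nsq_proj u)).add (hasFDerivAt_bsq u)
  rw [hsM.fderiv]
  simp

/-- `P` is differentiable. [folklore] -/
theorem differentiableAt_PM (u : 𝔼 4) : DifferentiableAt ℝ PM u :=
  (differentiableAt_nsq_proj u).mul (hasFDerivAt_bsq u).differentiableAt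

/-- `dP(v) = B(2u₀v₀ + 2u₁v₁) + A(2u₂v₂ + 2u₃v₃)`. [folklore] -/
theorem fderiv_PM_apply (u v : 𝔼 4) :
    fderiv ℝ PM u v = bsq u * (2 * u 0 * v 0 + 2 * u 1 * v 1) + nsq (proj u) * (2 * u 2 * v 2 + 2 * u 3 * v 3) := by
  have hPM : HasFDerivAt PM _ u := (hasFDerivAt_nsq_proj u).mul (hasFDerivAt_bsq u)
  rw [hPM.fderiv]
  simp
  ring

/-! ### The directional derivatives of `G` -/

variable {TP w : ℝ → ℝ} {c₀ ε κ η : ℝ}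

/-- **The derivative of `G` along a vector** (product and chain rules):
`dG(v) = s'(v)·V·W + s·(T_P'(P) P'(v) - s'(v))·W + s·V·w'·c₀·𝒯'(v)`, `V = T_P(P) - s`,
`W = w(c₀𝒯)`. [folklore] -/
theorem fderiv_satFn_apply (hTP : Differentiable ℝ TP) (hw : Differentiable ℝ w) {u : 𝔼 4}
    (hu : nsq (proj u) ≠ 0) (v : 𝔼 4) :
    fderiv ℝ (satFn TP w c₀ ε κ η) u v =
      fderiv ℝ (sM η) u v * (TP (PM u) - sM η u) * w (c₀ * tube ε κ η u) +
        sM η u * (deriv TP (PM u) * fderiv ℝ PM u v - fderiv ℝ (sM η) u v) * w (c₀ * tube ε κ η u) +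
        sM η u * (TP (PM u) - sM η u) * (deriv w (c₀ * tube ε κ η u) * (c₀ * fderiv ℝ (tube ε κ η) u v)) := by
  have hs := differentiableAt_sM η u
  have hP := differentiableAt_PM u
  have hT : DifferentiableAt ℝ (tube ε κ η) u := (contDiffAt_tube (m := 1) ε κ η hu).differentiableAt one_ne_zero
  have hV : HasFDerivAt (fun u => TP (PM u) - sM η u)
      (deriv TP (PM u) • fderiv ℝ PM u - fderiv ℝ (sM η) u) u :=
    ((hTP _).hasDerivAt.comp_hasFDerivAt u hP.hasFDerivAt).sub hs.hasFDerivAt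
  have hW : HasFDerivAt (fun u => w (c₀ * tube ε κ η u))
      (deriv w (c₀ * tube ε κ η u) • (c₀ • fderiv ℝ (tube ε κ η) u)) u :=
    (hw _).hasDerivAt.comp_hasFDerivAt u (hT.hasFDerivAt.const_smul c₀)
  have hG : HasFDerivAt (satFn TP w c₀ ε κ η) _ u := (hs.hasFDerivAt.mul hV).mul hW
  rw [hG.fderiv]
  simp only [add_apply, smul_apply, smul_eq_mul, sub_apply, Pi.mul_apply]
  ring

/-- `π(radialX u) = π u`. [folklore] -/
@[simp] theorem proj_radialX (u : 𝔼 4) : proj (radialX u) = proj u := by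
  ext i; fin_cases i <;> rfl

/-- `π(radialY u) = 0`. [folklore] -/
@[simp] theorem proj_radialY (u : 𝔼 4) : proj (radialY u) = 0 := by
  ext i; fin_cases i <;> rfl

/-- The planar core has zero radial derivative (it is homogeneous of degree `0`). [folklore] -/
theorem fderiv_gcore_self {x : 𝔼 2} (hx : nsq x ≠ 0) : fderiv ℝ (gcore ε) x x = 0 := by
  rw [fderiv_gcore ε hx]
  simp only [smul_apply, sub_apply, d0_apply, d1_apply, smul_eq_mul]
  ring

/-- The planar core along the rotation `(-x₁, x₀)`: `2ε x₀x₁/|x|²`. [folklore] -/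
theorem fderiv_gcore_rot {x : 𝔼 2} (hx : nsq x ≠ 0) (v : 𝔼 2) (hv0 : v 0 = -x 1) (hv1 : v 1 = x 0) :
    fderiv ℝ (gcore ε) x v = 2 * ε * x 0 * x 1 / nsq x := by
  rw [fderiv_gcore ε hx]
  simp only [smul_apply, sub_apply, d0_apply, d1_apply, smul_eq_mul, hv0, hv1]
  have hA : nsq x = x 0 ^ 2 + x 1 ^ 2 := nsq_apply x
  rw [hA] at hx ⊢
  field_simp
  ring

/-- The tube derivative along the radial field in `x⃗`: `(κ/η)·B·2A`. [folklore] -/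
theorem fderiv_tube_radialX {u : 𝔼 4} (hu : nsq (proj u) ≠ 0) :
    fderiv ℝ (tube ε κ η) u (radialX u) = κ / η * (bsq u * (2 * nsq (proj u))) := by
  rw [fderiv_tube_apply ε κ η hu, proj_radialX, fderiv_gcore_self hu, nsq_proj]
  simp only [radialX_apply_zero, radialX_apply_one, radialX_apply_two, radialX_apply_three]
  ring

/-- The tube derivative along the radial field in `y⃗`: `(κ/η)·A·2B`. [folklore] -/
theorem fderiv_tube_radialY {u : 𝔼 4} (hu : nsq (proj u) ≠ 0) :
    fderiv ℝ (tube ε κ η) u (radialY u) = κ / η * (nsq (proj u) * (2 * bsq u)) := by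
  rw [fderiv_tube_apply ε κ η hu, proj_radialY, map_zero, bsq_apply]
  simp only [radialY_apply_zero, radialY_apply_one, radialY_apply_two, radialY_apply_three]
  ring

/-- The tube derivative along the rotation field in `x⃗`: `2ε x₀x₁/A`. [folklore] -/
theorem fderiv_tube_rotX {u : 𝔼 4} (hu : nsq (proj u) ≠ 0) :
    fderiv ℝ (tube ε κ η) u (rotX u) = 2 * ε * u 0 * u 1 / nsq (proj u) := by
  rw [fderiv_tube_apply ε κ η hu, fderiv_gcore_rot hu (proj (rotX u)) rfl rfl]
  simp only [rotX_apply_zero, rotX_apply_one, rotX_apply_two, rotX_apply_three, proj_apply_zero, proj_apply_one]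
  ring

/-- `ds(radialX) = -2A`. [folklore] -/
theorem fderiv_sM_radialX (u : 𝔼 4) : fderiv ℝ (sM η) u (radialX u) = -(2 * nsq (proj u)) := by
  rw [fderiv_sM_apply, nsq_proj]
  simp only [radialX_apply_zero, radialX_apply_one, radialX_apply_two, radialX_apply_three]; ring
/-- `ds(radialY) = 2B`. [folklore] -/
theorem fderiv_sM_radialY (u : 𝔼 4) : fderiv ℝ (sM η) u (radialY u) = 2 * bsq u := by
  rw [fderiv_sM_apply, bsq_apply]
  simp only [radialY_apply_zero, radialY_apply_one, radialY_apply_two, radialY_apply_three]; ring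
/-- `ds(rotX) = 0`. [folklore] -/
theorem fderiv_sM_rotX (u : 𝔼 4) : fderiv ℝ (sM η) u (rotX u) = 0 := by
  rw [fderiv_sM_apply]
  simp only [rotX_apply_zero, rotX_apply_one, rotX_apply_two, rotX_apply_three]; ring
/-- `dP(radialX) = 2AB`. [folklore] -/
theorem fderiv_PM_radialX (u : 𝔼 4) : fderiv ℝ PM u (radialX u) = bsq u * (2 * nsq (proj u)) := by
  rw [fderiv_PM_apply, nsq_proj]
  simp only [radialX_apply_zero, radialX_apply_one, radialX_apply_two, radialX_apply_three]; ring
/-- `dP(radialY) = 2AB`. [folklore] -/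
theorem fderiv_PM_radialY (u : 𝔼 4) : fderiv ℝ PM u (radialY u) = nsq (proj u) * (2 * bsq u) := by
  rw [fderiv_PM_apply, bsq_apply]
  simp only [radialY_apply_zero, radialY_apply_one, radialY_apply_two, radialY_apply_three]; ring
/-- `dP(rotX) = 0`. [folklore] -/
theorem fderiv_PM_rotX (u : 𝔼 4) : fderiv ℝ PM u (rotX u) = 0 := by
  rw [fderiv_PM_apply]
  simp only [rotX_apply_zero, rotX_apply_one, rotX_apply_two, rotX_apply_three]; ring

/-- **`dG` along the radial field in `x⃗`**: `2A · α`,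
`α = (-V + s(T_P' B + 1)) W + s V W' c₀ (κ/η) B`. [cite: GayKirby2016, §4, Lemma 14] -/
theorem fderiv_satFn_radialX (hTP : Differentiable ℝ TP) (hw : Differentiable ℝ w) {u : 𝔼 4}
    (hu : nsq (proj u) ≠ 0) :
    fderiv ℝ (satFn TP w c₀ ε κ η) u (radialX u) =
      2 * nsq (proj u) *
        ((-(TP (PM u) - sM η u) + sM η u * (deriv TP (PM u) * bsq u + 1)) * w (c₀ * tube ε κ η u) +
          sM η u * (TP (PM u) - sM η u) * deriv w (c₀ * tube ε κ η u) * c₀ * (κ / η) * bsq u) := by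
  rw [fderiv_satFn_apply hTP hw hu, fderiv_sM_radialX, fderiv_PM_radialX, fderiv_tube_radialX hu]
  ring

/-- **`dG` along the radial field in `y⃗`**: `2B · β`,
`β = (V + s(T_P' A - 1)) W + s V W' c₀ (κ/η) A`. [cite: GayKirby2016, §4, Lemma 14] -/
theorem fderiv_satFn_radialY (hTP : Differentiable ℝ TP) (hw : Differentiable ℝ w) {u : 𝔼 4}
    (hu : nsq (proj u) ≠ 0) :
    fderiv ℝ (satFn TP w c₀ ε κ η) u (radialY u) =
      2 * bsq u *
        (((TP (PM u) - sM η u) + sM η u * (deriv TP (PM u) * nsq (proj u) - 1)) * w (c₀ * tube ε κ η u) +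
          sM η u * (TP (PM u) - sM η u) * deriv w (c₀ * tube ε κ η u) * c₀ * (κ / η) * nsq (proj u)) := by
  rw [fderiv_satFn_apply hTP hw hu, fderiv_sM_radialY, fderiv_PM_radialY, fderiv_tube_radialY hu]
  ring

/-- **`dG` along the rotation field in `x⃗`**: `s V W' c₀ · 2ε x₀x₁/A`. [cite: GayKirby2016, §4, Lemma 14] -/
theorem fderiv_satFn_rotX (hTP : Differentiable ℝ TP) (hw : Differentiable ℝ w) {u : 𝔼 4}
    (hu : nsq (proj u) ≠ 0) :
    fderiv ℝ (satFn TP w c₀ ε κ η) u (rotX u) =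
      sM η u * (TP (PM u) - sM η u) * deriv w (c₀ * tube ε κ η u) * c₀ * (2 * ε * u 0 * u 1 / nsq (proj u)) := by
  rw [fderiv_satFn_apply hTP hw hu, fderiv_sM_rotX, fderiv_PM_rotX, fderiv_tube_rotX hu]
  ring

/-! ### The critical points lie on the axes of the stable disc at height `T_P(0)/2` -/

/-- **The shape of the critical set on the tube saturation.**  If `dG(u) = 0` at a point with
`x⃗ ≠ 0`, `s > 0`, `V = T_P(P) - s > 0`, `W = w(c₀𝒯) > 0`, `W' < 0`, `T_P'(P) ≤ 0` and
`c₀, ε, κ/η > 0`, then `y⃗ = 0`, `x₀x₁ = 0` and `2s = T_P(0)`. [cite: GayKirby2016, §4, Lemma 14] -/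
theorem eq_of_fderiv_satFn_eq_zero (hTP : Differentiable ℝ TP) (hw : Differentiable ℝ w) {u : 𝔼 4}
    (hu : nsq (proj u) ≠ 0) (hs : 0 < sM η u) (hV : 0 < TP (PM u) - sM η u)
    (hW : 0 < w (c₀ * tube ε κ η u)) (hW' : deriv w (c₀ * tube ε κ η u) < 0)
    (hTP' : deriv TP (PM u) ≤ 0) (hc₀ : 0 < c₀) (hε : 0 < ε) (hκ : 0 < κ / η)
    (h0 : fderiv ℝ (satFn TP w c₀ ε κ η) u = 0) :
    bsq u = 0 ∧ u 0 * u 1 = 0 ∧ 2 * sM η u = TP 0 := by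
  have hApos : 0 < nsq (proj u) := lt_of_le_of_ne (by rw [nsq_apply]; positivity) (Ne.symm hu)
  have hBnn : 0 ≤ bsq u := bsq_nonneg u
  set s := sM η u
  set V := TP (PM u) - sM η u
  set W := w (c₀ * tube ε κ η u)
  set W' := deriv w (c₀ * tube ε κ η u)
  set A := nsq (proj u)
  set B := bsq u
  -- the three directional derivatives vanish
  have hX := fderiv_satFn_radialX (c₀ := c₀) (ε := ε) (κ := κ) (η := η) hTP hw hu
  have hY := fderiv_satFn_radialY (c₀ := c₀) (ε := ε) (κ := κ) (η := η) hTP hw hu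
  have hR := fderiv_satFn_rotX (c₀ := c₀) (ε := ε) (κ := κ) (η := η) hTP hw hu
  rw [h0, zero_apply] at hX hY hR
  -- rotation: `x₀ x₁ = 0`
  have hrot : u 0 * u 1 = 0 := by
    have hcoef : s * V * W' * c₀ ≠ 0 := by
      have : s * V * W' * c₀ < 0 := by
        have h1 : 0 < s * V := mul_pos hs hV
        nlinarith [mul_pos h1 hc₀]
      exact this.ne
    have : 2 * ε * u 0 * u 1 / A = 0 := by
      rcases mul_eq_zero.1 hR.symm with h | h
      · exact absurd h hcoef
      · exact h
    rw [div_eq_zero_iff] at this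
    rcases this with h | h
    · have : 2 * ε * (u 0 * u 1) = 0 := by linarith [h]
      rcases mul_eq_zero.1 this with h' | h'
      · linarith
      · exact h'
    · exact absurd h hu
  -- radial in `x⃗`: `α = 0`
  have hα : (-V + s * (deriv TP (PM u) * B + 1)) * W + s * V * W' * c₀ * (κ / η) * B = 0 := by
    rcases mul_eq_zero.1 hX.symm with h | h
    · rcases mul_eq_zero.1 h with h' | h'
      · linarith
      · exact absurd h' hu
    · exact h
  -- `B = 0`: otherwise `β = 0` too and `α + β < 0`
  have hB : B = 0 := by
    by_contra hBne
    have hBpos : 0 < B := lt_of_le_of_ne hBnn (Ne.symm hBne)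
    have hβ : (V + s * (deriv TP (PM u) * A - 1)) * W + s * V * W' * c₀ * (κ / η) * A = 0 := by
      rcases mul_eq_zero.1 hY.symm with h | h
      · rcases mul_eq_zero.1 h with h' | h'
        · linarith
        · exact absurd h' hBne
      · exact h
    have hsum : (-V + s * (deriv TP (PM u) * B + 1)) * W + s * V * W' * c₀ * (κ / η) * B +
        ((V + s * (deriv TP (PM u) * A - 1)) * W + s * V * W' * c₀ * (κ / η) * A) =
        s * (A + B) * (deriv TP (PM u) * W + V * W' * c₀ * (κ / η)) := by ring
    have hneg : s * (A + B) * (deriv TP (PM u) * W + V * W' * c₀ * (κ / η)) < 0 := by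
      have h1 : 0 < s * (A + B) := mul_pos hs (by linarith)
      have h2 : deriv TP (PM u) * W + V * W' * c₀ * (κ / η) < 0 := by
        have h3 : deriv TP (PM u) * W ≤ 0 := mul_nonpos_of_nonpos_of_nonneg hTP' hW.le
        have h4 : V * W' * c₀ * (κ / η) < 0 := by
          have := mul_pos (mul_pos hV hc₀) hκ
          nlinarith
        linarith
      exact mul_neg_of_pos_of_neg h1 h2
    rw [← hsum, hα, hβ, add_zero] at hneg
    exact lt_irrefl _ hneg
  -- with `B = 0`: `P = 0` and `α = (s - V) W`
  have hP0 : PM u = 0 := by show A * B = 0; rw [hB, mul_zero]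
  refine ⟨hB, hrot, ?_⟩
  rw [hB] at hα
  simp only [mul_zero, zero_add, add_zero, mul_one] at hα
  have : (-V + s) * W = 0 := by linarith [hα]
  rcases mul_eq_zero.1 this with h | h
  · have hVs : V = s := by linarith
    have : TP (PM u) = 2 * s := by
      have : V = TP (PM u) - s := rfl
      linarith
    rw [hP0] at this
    linarith
  · exact absurd h hW.ne'

/-- **No critical point of the second sector's function on the tube saturation below height
`T_P(0)/2`.** [cite: GayKirby2016, §4, Lemma 14] -/
theorem fderiv_satFn_ne_zero (hTP : Differentiable ℝ TP) (hw : Differentiable ℝ w) {u : 𝔼 4}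
    (hu : nsq (proj u) ≠ 0) (hs : 0 < sM η u) (hV : 0 < TP (PM u) - sM η u)
    (hW : 0 < w (c₀ * tube ε κ η u)) (hW' : deriv w (c₀ * tube ε κ η u) < 0)
    (hTP' : deriv TP (PM u) ≤ 0) (hc₀ : 0 < c₀) (hε : 0 < ε) (hκ : 0 < κ / η)
    (hlow : 2 * sM η u < TP 0) :
    fderiv ℝ (satFn TP w c₀ ε κ η) u ≠ 0 := fun h0 =>
  absurd (eq_of_fderiv_satFn_eq_zero hTP hw hu hs hV hW hW' hTP' hc₀ hε hκ h0).2.2 hlow.ne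

end TubeSaturation

end Literature.Topology.FourManifolds

end
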